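import Literature.Claims.NS.ClayVariants
import Literature.Analysis.FluidPDE.NSLerayHopf
import Literature.Analysis.FluidPDE.TaoAveragedEuler
import HarnessLib

/-!
# Claim skeleton C18 — Zhai 2014/2016, "Regularity of weak solutions to the Navier-Stokes equations (III)"

**Cite header.** Jian Zhai (Zhejiang University), *Regularity of weak solutions to the Navier-Stokes
equations (III) — Frequency overlapping* (v3 title l.255; abstract: «If u is a Leray-Hopf solution to
the Navier-Stokes equations with the initial data in L²(ℝ³), then u is regular»), arXiv:1409.7868
[math.AP], never published, TEXT OF RECORD = **v3** (8 Feb 2016, 38 pp.; TeX source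
`sources/Zhai2014/arxiv-1409.7868/v3-2016-02-08-ns-r218-2016-2-6.tex`, line numbers `l.` below refer
to it, PDF pages `p.` to the v3 PDF); v4 (2016) is the author's WITHDRAWAL «due to a crucial error in
section 6» (arXiv comment field). Bib key `Zhai2014`. [cite: Zhai2014, Thm. 1.1, p. 1]
This file is a CLAIM SKELETON of the D-0090 NS-claims sweep (cell `ns-claims`, row C18): it TYPES the
claimed theorem and the paper's own intermediate assertions as `Prop`s, asserts none of them, and
proves only the composition `claim_of_steps` and the Clay link `clay_of_claimed`. Nothing here is a
theorem about Navier–Stokes.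

**Claimed statement (verbatim, Thm. 1.1, l.298–301, p.1).** «If `u` is a Leray-Hopf solution to the
problem (1.1) with the initial data `u₀ ∈ L²(ℝ³)`, then `u` is regular.» Here (1.1) (l.286–293) is
the incompressible Navier–Stokes system on `ℝ³ × (0,T)` with `ν = 1`, `f ≡ 0`; «We call `u` is a
smooth solution in `ℝ³ × (0,T)` to (1.1) if it is a weak solution of (1.1) and
`u ∈ C^∞(ℝ³ × (0,T))`» (l.296–297); Leray–Hopf class = (1)–(3) of l.305–316 (the tree's
`Literature.Analysis.FluidPDE.IsLerayHopfOn`). Typed as `ClaimedTheorem`.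

**Clay delta.** Thm. 1.1 asserts regularity of EVERY Leray–Hopf solution from `L²` data on `ℝ³`
(`ν = 1`, `f ≡ 0`): this is STRONGER than Fefferman's (A) (`clayR3.Regularity`: Schwartz-class data,
one smooth bounded-energy solution). No wrong-problem axis: domain `ℝ³` ✓, `f ≡ 0` ✓, `ν = 1` is
(A) at one viscosity, equivalent to (A) by `ClayVariants.clayR3_regularityAt_iff`. The link
`clay_of_claimed : leray_existence_R3 → LHBridge → ClaimedTheorem → clayR3.Regularity` is PROVED
below; `leray_existence_R3` is a tree THEOREM (`leray_existence_R3_holds`,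
`Literature/Analysis/FluidPDE/NSLerayExistenceR3Holds.lean`, not imported here to keep the
skeleton light), and `LHBridge` (smooth-data bookkeeping: a global Leray–Hopf solution from a Clay
datum that is `C^∞` on every `ℝ³ × (0,T)` is a Clay-sense solution) is the only named delta.

**Architecture of the printed proof (print order) and ORDERED STEP INDEX.** Every `Step_k` is a
`def … : Prop` restating one printed intermediate assertion with its locator; none is asserted.
* `Step_1`  — §1 l.317–343 p.2 + §6.1 l.1637–1640 p.23: Leray's structure / first blow-up time: a
  Leray–Hopf solution that is not regular yields, after re-basing at a regular time, a BLOW-UP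
  ELEMENT `IsBlowup` (classical on `[0,T)`, Leray–Hopf beyond `T`, `T` its first singular time).
* `Step_2`  — (3.1) l.726–732 p.9: a radial Littlewood–Paley cut-off `φ` exists (`IsLPCutoff`).
* `Step_3`  — Prop. 3.2 l.1035–1060 p.14 («Assumption 1» (3.11)) + Lemmas 4.1–4.3 l.1191–1436
  pp.17–20 + §6.5 l.2226–2231 p.35: the CRITERION — Assumption 1 at some time `t < T` for a
  solution classical on `[0,T)` ⇒ «`u` can be extended smoothly over `T`».
* `Step_4`  — §6.1–§6.2 l.1635–1714 pp.23–25: REDUCTION BY SCALING — if a blow-up element exists,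
  then (near-extremal datum, rescalings `λ_δ`, `λ_γ`, Lemma 2.1 dichotomy, WLOG `h₀ = 0`) there is a
  blow-up element that either satisfies Assumption 1 at some time or satisfies (6.3); the UNPRINTED
  data conditions at the re-based time that §6.3–§6.4 use (referee L0) are typed explicitly as
  `RebasedData` and made part of this Step's conclusion (the print's «Simply we assume h₀ = 0»).
* `Step_5`  — Lemma 6.1 l.1742–1747 p.25: `‖∇ₓ(u(h) − S(h)u₀)‖_{L¹} ≤ C(‖u₀‖₂² + T‖u₀‖₂‖∇²u₀‖₂)`.
* `Step_6`  — §6.4 (3.24) l.1827, (3.29) l.1831, (3.33)/(3.35) l.2053–2062, (6.8.0) l.2119–2121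
  pp.29–33: the PARAMETER CHOICE (`Params.Printed`, `Scales.Fit`) is possible (pure real arithmetic).
* `Step_7`  — Lemma 6.2 l.2117–2127 p.33 AS USED («Particularly at `h = t` we have (3.11)», and
  §6.5): under (6.3) + the parameter web, (6.9.2)/(3.40) hold on `(h₀, t]` and Assumption 1 holds
  at `t`. Sub-steps of its proof, typed for the verdict's by-decl grain (HYGIENE 13):
  `Step_7a` (proof Step 1, l.2131–2165, printed (6.9.1) «`E' < −D`») and `Step_7a'` (charitable:
  `E' < 0`, which is all (6.9.2) uses) over the displayed quantities `Displayed`/`Ineq338` of (3.38);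
  `Step_7b` (proof Steps 2–3, l.2168–2218: the dichotomy (3.40.1) ⇒ (6.33) or (6.36), «provided
  (6.38)»); `Step_7c` (the CLOSURE l.2219–2223 «Then we can return to the Step 1 by replacing `h₀`
  by `h₁`»: the restart of (6.8) at `h₁` from (6.36)), concrete.
* Companions (F15, NOT steps of the printed proof, not consumed by `claim_of_steps`):
  `RestartWindow` (the real-number grain of `Step_7c`: Prop. 5.1 restarted at `h₁` with
  `K₀ = ‖u₀‖₂^{-2}` has, by (5.5), a window `≥ h₀ = T^{1+4γ₁}`), `QPlusPropagation` (the grain of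
  propagating the `u^{Q+}`-smallness by the monotonicity of `E`), `ShellOrdering` (l.1846–1849 «`1 <
  ε_c < 2`» against (3.35)/(6.8.0) «`ε_c = ½`», F-level print inconsistency), and the charitable
  parameter variant `Params.PrintedCharitable` / `Step_7'` (`1 < ε_c < 2` in place of `ε_c = ½`).
* NOT TYPED concretely (documented gap of this skeleton, not of the paper): the derivation of the
  second `L²–L^∞` inequality (3.21)–(3.38) l.1853–2111 pp.29–33 (multiplier calculus on the shells
  (3.29.1) with the discrete weights (3.30.1)); its SHAPE is the vocabulary `Displayed.Ineq338`,
  taken as a hypothesis by `Step_7a`/`Step_7a'`. Prop. 5.1 / Cor. 5.2 (§5, recalled from [BR]) enter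
  only through the hypothesis `RebasedData.vorticity_55` and the conclusion shape
  `HighFreqVorticityDecay` ((6.8)).

**COMPOSITION.** `claim_of_steps : Step_1 → Step_2 → Step_3 → Step_4 → Step_6 → Step_7 →
ClaimedTheorem` — PROVED (by contradiction: a non-regular Leray–Hopf solution gives a blow-up
element (`Step_1`); `Step_4` upgrades it to one satisfying Assumption 1 directly or (6.3) +
`RebasedData`; in the second case `Step_6` chooses the scales and `Step_7` gives Assumption 1 at
`t`; `Step_3` then continues the solution smoothly past its first singular time — absurd).
`Step_5` (Lemma 6.1) is consumed inside the printed proof of Lemma 6.2 ((3.37)), i.e. by `Step_7`,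
not by the composition. composes: YES.

**Typing conventions / faithfulness notes (F-level, no verdict).**
* Fourier side. The paper's `𝓕` is not normalised explicitly; we use Mathlib's `𝓕` (kernel
  `e^{-2πi⟪x,ξ⟫}`) through the tree's function-level `fourierVec` (Bochner: JUNK `0` off `L¹`,
  TYPING-HYGIENE §2). Every Fourier-side predicate below therefore carries an explicit
  `Integrable` guard on the field being transformed (`AssumptionOne`, `HighFreqVorticityDecay`);
  weighted Fourier energies are lower Lebesgue integrals in `[0,∞]` (no junk). By (2.1)/(2.2.5)
  (l.547–566: `‖w(τ)‖₂ = (T−t)^{-1/4}‖u(t)‖₂`) and Plancherel, the self-similar quantity of (3.11)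
  equals `(T−t)^{-1/2} ∫ (χ(λ_t η)² + 1 − φ(λ_t η)²)|𝓕[u(t)](η)|² dη`, `λ_t = (T−t)^{1/2}` (Motivation 1,
  l.375–379): this x-variable form is what `a1Quantity` types.
* `‖∇v‖_{L²}`, `‖∇v‖_{L¹}`, `‖∇²v‖_{L²}` are typed junk-free in `[0,∞]` with the Frobenius norm
  (`eGradL2`, `eGradL1`, `eHessL2`); `‖v‖_{L²}` as the real number `l2 v` (every use is under an
  `L²` hypothesis).
* (6.3) line 2 prints `‖u₀‖₂ ≤ T^{¼−γ₁} δ̂^{1/2}/2 ≤ δ^{1/2}/2`, both ends being EQUAL by the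
  definition of `δ` at l.1693; typed as the equality `Satisfies63.norm_eq` (referee F2). The typo
  l.1666 `û₀ := λ_δ^{-1/2} ũ₀(λ_δ x)` (NS scaling is `λ ũ₀(λ x)`, whose norm (6.1) the text uses) is
  not typed (the rescalings are internal to `Step_4`).
* Name clash in the print: the good times `h_j ↑ T` of §6.2/(6.3) (`Satisfies63.goodTimes`, with
  «`h₀ = 0`») are NOT the `h₀ = T^{1+4γ₁} < h₁ < …` of Lemma 6.2 (`Scales`, `Step_7a–c`).
* (6.9.1) l.2155–2158 prints `d/dh E < −D`, which does not follow from (3.38) (`E' ≤ −D·(1 − small)`);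
  only `E' < 0` is used at (6.9.2). Both readings are typed (`Step_7a`, `Step_7a'`).
* The constants `M₂` (Prop. 5.1, l.1538–1561) and `C` of Lemma 6.1 are absolute but not numerically
  printed; Steps that need them quantify `∃ M₂ > 0`/`∃ C > 0` (claims) and `∀ M₂ C` (reductions).

WHAT THIS IS NOT: not a proof or refutation of any statement about the Navier–Stokes equations; not
an endorsement of or a verdict on arXiv:1409.7868 (the verdict is the refuter's and the referee's, in
the cell's grammar); no `Step_k` below is asserted — each is a `Prop` restating a printed intermediate
claim with its locator, and the only theorems are the composition `claim_of_steps` and the Clay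
bookkeeping `clay_of_claimed`; not a claim about the author beyond the typed locators of the v3 text
of record (v4 = the author's own withdrawal «crucial error in section 6»).
-/

open Set MeasureTheory Filter Topology
open Literature.Analysis.FluidPDE Literature.Analysis.UnboundedOperators
open scoped ContDiff ENNReal NNReal

namespace Literature.Claims.NS.Zhai2014

noncomputable section

/-- `ℝ³` as a Euclidean space (the paper's `ℝ³`, l.286). [cite: Zhai2014, (1.1), p. 1] -/
abbrev R3 : Type := EuclideanSpace ℝ (Fin 3)

/-! ## Vocabulary, in print order -/

/-- The Littlewood–Paley cut-off of (3.1) (l.726–732, p.9; also Motivation 1, l.361–367, p.3):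
`φ ∈ C_c^∞(ℝ³, [0,1])` radial, `φ(ξ) = 1` for `|ξ| ≤ 1`, `φ(ξ) = 0` for `|ξ| ≥ 2`,
`ξ·∇φ(ξ) ≤ 0` for all `ξ`. [cite: Zhai2014, (3.1), p. 9] -/
structure IsLPCutoff (φ : R3 → ℝ) : Prop where
  smooth : ContDiff ℝ ∞ φ
  mem_Icc : ∀ ξ, φ ξ ∈ Icc (0 : ℝ) 1
  radial : ∀ ξ ξ' : R3, ‖ξ‖ = ‖ξ'‖ → φ ξ = φ ξ'
  eq_one : ∀ ξ : R3, ‖ξ‖ ≤ 1 → φ ξ = 1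
  eq_zero : ∀ ξ : R3, 2 ≤ ‖ξ‖ → φ ξ = 0
  radialDeriv_nonpos : ∀ ξ : R3, (fderiv ℝ φ ξ) ξ ≤ 0

/-- The modified low-frequency weight `χ` (Motivation 1 l.368–373 p.3; §3 l.872–877 p.12), for
`α ∈ (0, 1/8)`: `χ(ξ) = (|ξ|/(½+α))^{½+2α}` for `|ξ| ≤ ½+α`, `χ(ξ) = φ(ξ)` for `|ξ| ≥ ½+α`.
[cite: Zhai2014, Motivation 1, p. 3] -/
def chi (α : ℝ) (φ : R3 → ℝ) (ξ : R3) : ℝ :=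
  if ‖ξ‖ ≤ 1 / 2 + α then (‖ξ‖ / (1 / 2 + α)) ^ (1 / 2 + 2 * α) else φ ξ

/-- `λ_t := (T − t)^{1/2}` (Motivation 1 l.375; §6.4 l.1820). [cite: Zhai2014, §6.4, p. 29] -/
def timeScale (T t : ℝ) : ℝ := Real.sqrt (T - t)

/-- Weighted Fourier energy `∫ w(η) |𝓕[v](η)|² dη ∈ [0,∞]` of a real vector field `v : ℝ³ → ℝ³`
(lower Lebesgue integral, no junk in the integral; `fourierVec v` itself is Bochner and is honest only
for `v ∈ L¹` — every predicate using this carries an `Integrable v` guard). [folklore] -/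
def fourierEnergy (w : R3 → ℝ) (v : R3 → R3) : ℝ≥0∞ :=
  ∫⁻ η, ENNReal.ofReal (w η * ‖fourierVec v η‖ ^ 2)

/-- `‖Δ̃ᵗ₋₁ v‖²_{L²}` in x-variables: the weight `χ(λ_t η)²` (Motivation 1 l.378; §6.4 l.1822).
[cite: Zhai2014, §6.4, p. 29] -/
def lowWeight (φ : R3 → ℝ) (α T t : ℝ) (η : R3) : ℝ :=
  chi α φ (timeScale T t • η) ^ 2

/-- `‖√Δ₀ᵗ v‖²_{L²}` in x-variables: the weight `1 − φ(λ_t η)²` (Motivation 1 l.377; (3.2) l.735–741;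
§6.4 l.1821). [cite: Zhai2014, (3.2), p. 9] -/
def highWeight (φ : R3 → ℝ) (T t : ℝ) (η : R3) : ℝ :=
  1 - φ (timeScale T t • η) ^ 2

/-- `‖Δ̃ᵗ₋₁ v‖_{L²} + ‖√Δ₀ᵗ v‖_{L²} ∈ [0,∞]` (the left side of (3.39)/(6.9.2)/(3.40), l.2149–2165,
in x-variables). [cite: Zhai2014, (6.9.2), p. 34] -/
def lowHighNorm (φ : R3 → ℝ) (α T t : ℝ) (v : R3 → R3) : ℝ≥0∞ :=
  fourierEnergy (lowWeight φ α T t) v ^ (1 / 2 : ℝ) + fourierEnergy (highWeight φ T t) v ^ (1 / 2 : ℝ)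

/-- `‖Δ̃ᵗ₋₁ v‖²_{L²} + ‖√Δ₀ᵗ v‖²_{L²} ∈ [0,∞]` (the energy of (3.38.1) l.2103–2111 and of (6.33)
l.2185–2188, in x-variables). [cite: Zhai2014, (3.38.1), p. 33] -/
def lowHighEnergy (φ : R3 → ℝ) (α T t : ℝ) (v : R3 → R3) : ℝ≥0∞ :=
  fourierEnergy (lowWeight φ α T t) v + fourierEnergy (highWeight φ T t) v

/-- The quantity of «Assumption 1» (3.11) (l.1037–1041, p.14) transported to x-variables by (2.1),
(2.2.5) (l.547–566) and Plancherel: `∫ |Δ̃₋₁w(τ₀)|² + |√Δ₀ w(τ₀)|² dy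
= (T−t₀)^{-1/2} ∫ (χ(λ_{t₀}η)² + 1 − φ(λ_{t₀}η)²)|𝓕[u(t₀)](η)|² dη`, `τ₀ = −ln(T − t₀)`.
[cite: Zhai2014, (3.11), p. 14] -/
def a1Quantity (φ : R3 → ℝ) (α T t : ℝ) (v : R3 → R3) : ℝ≥0∞ :=
  ENNReal.ofReal (timeScale T t)⁻¹ * lowHighEnergy φ α T t v

/-- «Assumption 1» (3.11) at x-time `t` for blow-up time `T`, threshold `δ`, for the slice `v = u(t)`:
`(∫ |Δ̃₋₁w(τ₀)|² + |√Δ₀w(τ₀)|²)^{1/2} ≤ δ^{1/2}` (l.1037–1041, p.14), with the `L¹` guard making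
`fourierVec v` honest (typing convention, module docstring). [cite: Zhai2014, (3.11), p. 14] -/
def AssumptionOne (φ : R3 → ℝ) (α δ T t : ℝ) (v : R3 → R3) : Prop :=
  Integrable v volume ∧ a1Quantity φ α T t v ≤ ENNReal.ofReal δ

/-- «`u` is regular» on `ℝ³ × (0,T)` (l.296–297, p.1: «a weak solution of (1.1) and
`u ∈ C^∞(ℝ³ × (0,T))`»): the time slices of `u` agree a.e. with a field jointly smooth on
`(0,T) × ℝ³`. [cite: Zhai2014, §1, p. 1] -/
def IsRegularOn (T : ℝ) (u : ℝ → R3 → R3) : Prop :=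
  ∃ v : ℝ → R3 → R3, IsSmoothSpaceTimeOn (Ioo 0 T) v ∧ ∀ t ∈ Ioo 0 T, u t =ᵐ[volume] v t

/-- **The claimed theorem, verbatim** (Thm. 1.1, l.298–301, p.1): «If `u` is a Leray-Hopf solution
to the problem (1.1) [`ν = 1`, `f ≡ 0`, `ℝ³ × (0,T)`] with the initial data `u₀ ∈ L²(ℝ³)`, then `u`
is regular.» Leray–Hopf = the tree's `IsLerayHopfOn` ((1)–(3) of l.305–316). [cite: Zhai2014, Thm. 1.1, p. 1] -/
def ClaimedTheorem : Prop :=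
  ∀ (T : ℝ) (u₀ : R3 → R3) (u : ℝ → R3 → R3), 0 < T → MemLp u₀ 2 volume →
    IsLerayHopfOn T 1 0 u₀ u → IsRegularOn T u

/-- A BLOW-UP ELEMENT `(T, u₀, u, p)` (§6.1 l.1637–1640, p.23: «`T̃ > 0` is the first blow-up time
of the Leray-Hopf solution with the initial data `ũ₀`»; §6.2 works with `u` classical on `[0,T)`
after the re-basing «Simply we assume `h₀ = 0`», l.1685): `u` is a Leray–Hopf solution from `u₀` on
some `[0,T₊)`, `T₊ > T` (binder `Tplus`), classical with pressure `p` on `[0,T)`, and `T` is its first singular time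
(`u` is regular on no `(0,T'')`, `T'' > T`). [cite: Zhai2014, §6.1, p. 23] -/
structure IsBlowup (T : ℝ) (u₀ : R3 → R3) (u : ℝ → R3 → R3) (p : ℝ → R3 → ℝ) : Prop where
  pos : 0 < T
  horizon : ∃ Tplus : ℝ, T < Tplus ∧ IsLerayHopfOn Tplus 1 0 u₀ u
  classical : IsClassicalNSSolutionOn (Ico 0 T) 1 0 u p
  initial : u 0 = u₀
  first_blowup : ∀ T'' : ℝ, T < T'' → ¬ IsRegularOn T'' u

/-- A SMOOTH EPOCH `(T, u₀, u, p)`: the part of a blow-up element that the proofs of Lemma 6.1 and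
Lemma 6.2 actually use (§6.3–§6.4 never use that `u` blows up at `T`): `u` is Leray–Hopf from `u₀` on
some `[0,T₊) ⊇ [0,T)` and classical with pressure `p` on `[0,T)`, `u(0) = u₀`. Steps 5, 7, 7b, 7c are
typed over smooth epochs (the generality of their printed proofs), which only strengthens them
relative to the blow-up element of §6.2. [cite: Zhai2014, §6.2 l.1680–1686, p. 24] -/
structure IsSmoothEpoch (T : ℝ) (u₀ : R3 → R3) (u : ℝ → R3 → R3) (p : ℝ → R3 → ℝ) : Prop where
  pos : 0 < T
  horizon : ∃ Tplus : ℝ, T ≤ Tplus ∧ IsLerayHopfOn Tplus 1 0 u₀ u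
  classical : IsClassicalNSSolutionOn (Ico 0 T) 1 0 u p
  initial : u 0 = u₀

/-- A blow-up element is a smooth epoch (field projection). [cite: Zhai2014, §6.2, p. 24] -/
theorem IsBlowup.isSmoothEpoch {T : ℝ} {u₀ : R3 → R3} {u : ℝ → R3 → R3} {p : ℝ → R3 → ℝ}
    (h : IsBlowup T u₀ u p) : IsSmoothEpoch T u₀ u p := by
  obtain ⟨Tplus, hT, hLH⟩ := h.horizon
  exact ⟨h.pos, ⟨Tplus, hT.le, hLH⟩, h.classical, h.initial⟩

/-- `‖v‖_{L²(ℝ³)}` as a real number (junk `0` off `L²`; used only under `L²` hypotheses). [folklore] -/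
def l2 (v : R3 → R3) : ℝ := (eLpNorm v 2 volume).toReal

/-- `‖∇v‖_{L²(ℝ³)} ∈ [0,∞]` with the Frobenius norm `|∇v|² = Σᵢⱼ(∂ᵢvⱼ)²` (tree `frobeniusNormSq`);
no junk in the integral (`fderiv` is junk `0` off differentiability; all uses are on smooth slices).
[folklore] -/
def eGradL2 (v : R3 → R3) : ℝ≥0∞ :=
  (∫⁻ x, ENNReal.ofReal (frobeniusNormSq (fderiv ℝ v x))) ^ (1 / 2 : ℝ)

/-- `‖∇v‖_{L¹(ℝ³)} ∈ [0,∞]` (Frobenius pointwise norm). [folklore] -/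
def eGradL1 (v : R3 → R3) : ℝ≥0∞ :=
  ∫⁻ x, ENNReal.ofReal (Real.sqrt (frobeniusNormSq (fderiv ℝ v x)))

/-- `‖∇²v‖_{L²(ℝ³)} ∈ [0,∞]` (operator norm of the second Fréchet derivative). [folklore] -/
def eHessL2 (v : R3 → R3) : ℝ≥0∞ :=
  eLpNorm (iteratedFDeriv ℝ 2 v) 2 volume

/-- **(6.3)** (l.1708–1714, p.25) for the rescaled, re-based blow-up element, `γ₁ ∈ (0, 1/100)`,
`0 < δ̂ < δ₀` (l.1663): `T < (½)^{1/γ₁}`; `‖u₀‖₂ = T^{¼−γ₁} δ̂^{1/2}/2` (printed `≤ … ≤ δ^{1/2}/2`, both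
ends equal by the definition of `δ` at l.1693 — referee F2); `‖∇u₀‖₂ ≤ ‖u₀‖₂/(2T^{1/2})`; good times
`h_j ↑ T`, `h₀ = 0` (l.1685), with `‖∇u(h_j)‖₂ ≤ ‖u(h_j)‖₂/(2(T−h_j)^{1/2})`. (These `h_j` are NOT the
`h₀ = T^{1+4γ₁} < h₁` of Lemma 6.2.) [cite: Zhai2014, (6.3), p. 25] -/
structure Satisfies63 (γ₁ δhat T : ℝ) (u₀ : R3 → R3) (u : ℝ → R3 → R3) : Prop where
  T_lt : T < (1 / 2 : ℝ) ^ (1 / γ₁)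
  norm_eq : l2 u₀ = T ^ (1 / 4 - γ₁) * (Real.sqrt δhat / 2)
  grad_le : eGradL2 u₀ ≤ ENNReal.ofReal (l2 u₀ / (2 * Real.sqrt T))
  goodTimes : ∃ h : ℕ → ℝ, StrictMono h ∧ h 0 = 0 ∧ (∀ j, h j < T) ∧ Tendsto h atTop (𝓝 T) ∧
    ∀ j, eGradL2 (u (h j)) ≤ ENNReal.ofReal (l2 (u (h j)) / (2 * Real.sqrt (T - h j)))

/-- The parameter tuple of §6.2/§6.4: `α` (l.368, (3.35)), `γ₁` (l.1687, (6.3)), `ε`, `ε_b`, `ε_c`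
((3.35) l.2059–2062, (6.8.0) l.2119–2121), `δ̂` (l.1663). [cite: Zhai2014, (3.35) and (6.8.0), pp. 32–33] -/
structure Params where
  /-- `α` of `χ` and Prop. 3.2; `α ∈ (0, 1/12)` in (3.35)/(6.8.0). -/
  α : ℝ
  /-- `γ₁ ∈ (0, 1/100)` of the rescaling `λ_γ` and of `h₀ = T^{1+4γ₁}`. -/
  γ₁ : ℝ
  /-- `ε` of (3.35): `(T−t)^{½−β₁} := ‖u₀‖₂^{2+ε}`. -/
  ε : ℝ
  /-- `ε_b` of (3.35): `1 − b := ‖u₀‖₂^{ε_b}`. -/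
  ε_b : ℝ
  /-- `ε_c` of the shells (3.29.1): `ε_c = ½` by (3.35)/(6.8.0) (but «`1 < ε_c < 2`» at l.1849). -/
  ε_c : ℝ
  /-- `δ̂ ∈ (0, δ₀)` of the rescaling `λ_δ` (l.1663). -/
  δhat : ℝ

/-- The PRINTED parameter constraints, for a threshold `δ` of Assumption 1 (playing `δ₀`, l.1635):
`α ∈ (0, 1/12)`, `γ₁ ∈ (0, 1/100)` (l.1708), (6.8.0)/(3.35) «`1 ≫ 2(ε − 8γ₁) > ε_b > ε/(¾ − α)`,
`ε_c = ½`» (the informal `1 ≫` is not typed), `0 < δ̂ < δ₀` (l.1663).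
[cite: Zhai2014, (6.8.0), p. 33] -/
structure Params.Printed (P : Params) (δ : ℝ) : Prop where
  α_pos : 0 < P.α
  α_lt : P.α < 1 / 12
  γ₁_pos : 0 < P.γ₁
  γ₁_lt : P.γ₁ < 1 / 100
  ε_pos : 0 < P.ε
  web_upper : P.ε_b < 2 * (P.ε - 8 * P.γ₁)
  web_lower : P.ε / (3 / 4 - P.α) < P.ε_b
  ε_c_eq : P.ε_c = 1 / 2
  δhat_pos : 0 < P.δhat
  δhat_lt : P.δhat < δ

/-- CHARITABLE parameter constraints: as `Params.Printed` but with l.1849's «`1 < ε_c < 2`» in place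
of (3.35)/(6.8.0)'s `ε_c = ½` (referee L1: with `ε_c = ½` the shell `u^{Q+}` of (3.29.1) is empty and
`u^{Q−}` overlaps `u^{>Q+}`). Not a printed Step. [cite: Zhai2014, §6.4 l.1846–1849, p. 30] -/
structure Params.PrintedCharitable (P : Params) (δ : ℝ) : Prop where
  α_pos : 0 < P.α
  α_lt : P.α < 1 / 12
  γ₁_pos : 0 < P.γ₁
  γ₁_lt : P.γ₁ < 1 / 100
  ε_pos : 0 < P.ε
  web_upper : P.ε_b < 2 * (P.ε - 8 * P.γ₁)
  web_lower : P.ε / (3 / 4 - P.α) < P.ε_b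
  ε_c_gt : 1 < P.ε_c
  ε_c_lt : P.ε_c < 2
  δhat_pos : 0 < P.δhat
  δhat_lt : P.δhat < δ

/-- The time `t` of Lemma 6.2 and the exponents/scales of §6.4: `t ∈ (h₀, T)`, `β₀` of (3.24),
`β₁` of (3.29), `b` of (3.33)/(3.35). [cite: Zhai2014, (3.24) (3.29) (3.35), pp. 29–32] -/
structure Scales where
  /-- the fixed time `t ∈ (0,T)` of §6.4 (l.1820) at which (3.11) is to be verified. -/
  t : ℝ
  /-- `β₀` of (3.24): `σ₀ := (T−t)^{β₀}/λ_t`. -/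
  β₀ : ℝ
  /-- `β₁` of (3.29): `σ_Q := (T−t)^{β₁}/λ_t`, `0 < β₁ < β₀`. -/
  β₁ : ℝ
  /-- `b ∈ (½, 1)` of (3.33) (l.2053). -/
  b : ℝ

/-- The printed RELATIONS tying the scales to `(T, ‖u₀‖₂)` and the parameters: `h₀ = T^{1+4γ₁} < t < T`
(Lemma 6.2: «for `h > h₀` … Particularly at `h = t`», l.2117–2127); `0 < β₁ < β₀` ((3.29) l.1831);
(3.24) l.1827 `σ₀ = (T−t)^{β₀}/λ_t = δ/‖u₀‖₂² = 4` (`δ = 4‖u₀‖₂²` by l.1693); (3.35) l.2059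
`σ_Q^{-1} = (T−t)^{½−β₁} := ‖u₀‖₂^{2+ε}`, `1 − b := ‖u₀‖₂^{ε_b}`; `b ∈ (½,1)` (l.2053). Here `nrm`
stands for `‖u₀‖₂`. [cite: Zhai2014, (3.24) (3.29) (3.35), pp. 29–32] -/
structure Scales.Fit (S : Scales) (P : Params) (T nrm : ℝ) : Prop where
  h₀_lt : T ^ (1 + 4 * P.γ₁) < S.t
  t_lt : S.t < T
  β₁_pos : 0 < S.β₁
  β₁_lt : S.β₁ < S.β₀
  σ₀_eq : (T - S.t) ^ (S.β₀ - 1 / 2) = 4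
  σQ_eq : (T - S.t) ^ (1 / 2 - S.β₁) = nrm ^ (2 + P.ε)
  b_eq : 1 - S.b = nrm ^ P.ε_b
  b_gt : 1 / 2 < S.b
  b_lt : S.b < 1

/-- The right-hand side of (3.39)/(6.9.2) (l.2149–2165, p.34):
`2((1−b)^{ε_c} λ_t σ_Q)^{½+2α} ‖u₀‖₂ = 2((1−b)^{ε_c} (T−t)^{β₁})^{½+2α} ‖u₀‖₂` (`λ_t σ_Q = (T−t)^{β₁}`
by (3.29)). [cite: Zhai2014, (6.9.2), p. 34] -/
def bound692 (P : Params) (S : Scales) (T nrm : ℝ) : ℝ :=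
  2 * ((1 - S.b) ^ P.ε_c * (T - S.t) ^ S.β₁) ^ (1 / 2 + 2 * P.α) * nrm

/-- UNPRINTED DATA CONDITIONS AT THE RE-BASED TIME (referee L0), i.e. what the WLOG «Simply we
assume `h₀ = 0`» (l.1685) must supply for §6.3–§6.4 to apply, each with the locator of its USE:
(i) Prop. 5.1's hypothesis (5.5) l.1580 `4K₀M₂(T* − t₀)^{1/4} ≤ 7/16`, `K₀ = ‖ω(t₀)‖₂`, applied at
(6.8) l.2132–2136 from `t₀ = 0` with `T* = h₀ = T^{1+4γ₁}`, i.e. `‖ω(0)‖₂ ≤ (7/(64M₂)) T^{−(1+4γ₁)/4}`;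
(ii) Lemma 6.1's `∇²u₀ ∈ L²` (l.1742); (iii) (3.37) l.2064–2071: `‖∇u₀‖_{L¹} < ∞`; (iv) the second
line of (3.33) l.2056 in the form (3.37) delivers it («utilizing section 6.2 and Lemma 6.1»), with
(3.35) substituted (`(T−t)^{½−β₁} = ‖u₀‖₂^{2+ε}`, `1 − b = ‖u₀‖₂^{ε_b}`) and `‖∇ₓu(h)‖_{L¹} ≤
‖∇ₓv(h)‖_{L¹} + ‖∇ₓS(h)u₀‖_{L¹} ≤ C(‖u₀‖₂² + T‖u₀‖₂‖∇²u₀‖₂) + ‖∇u₀‖_{L¹}`: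
`((1−b)^{2ε_c} + (1−b)^{1−(1−ε_c)(½+2α)})·(C(‖u₀‖₂² + T‖u₀‖₂‖∇²u₀‖₂) + ‖∇u₀‖_{L¹}) ≤ ‖u₀‖₂^{2+ε}/100`.
`M₂` = the constant of Prop. 5.1 (l.1538–1561), `C₆₁` = the constant of Lemma 6.1.
[cite: Zhai2014, (5.5) p. 22, Lemma 6.1 p. 25, (3.33) (3.37) p. 32] -/
structure RebasedData (M₂ C₆₁ : ℝ) (P : Params) (T : ℝ) (u₀ : R3 → R3) : Prop where
  vorticity_55 : eLpNorm (curl u₀) 2 volume ≤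
    ENNReal.ofReal (7 / (64 * M₂) * T ^ (-(1 + 4 * P.γ₁) / 4))
  hess_finite : eHessL2 u₀ < ⊤
  gradL1_finite : eGradL1 u₀ < ⊤
  smallness_337 :
    ((l2 u₀ ^ P.ε_b) ^ (2 * P.ε_c) + (l2 u₀ ^ P.ε_b) ^ (1 - (1 - P.ε_c) * (1 / 2 + 2 * P.α))) *
        (C₆₁ * (l2 u₀ ^ 2 + T * l2 u₀ * (eHessL2 u₀).toReal) + (eGradL1 u₀).toReal) ≤
      l2 u₀ ^ (2 + P.ε) / 100

/-! ## The Steps (print order). Each is a `Prop`; none is asserted. -/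

/-- **Step 1** (§1 l.317–343 p.2; §6.1 l.1637–1640 p.23; the re-basing l.1685 p.24): Leray's
structure theorem and weak–strong uniqueness as the paper uses them — a Leray–Hopf solution on
`[0,T)` from `u₀ ∈ L²` that is NOT regular on `(0,T)` has a first singular time; re-based at a
regular time `t₁` before it, `s ↦ u(t₁ + s)` is (a.e.) a BLOW-UP ELEMENT with lifespan `T' ≤ T − t₁`.
Classical in content ([L], [G] of the paper's bibliography). [cite: Zhai2014, §1 l.317–343, p. 2] -/
def Step_1 : Prop :=
  ∀ (T : ℝ) (u₀ : R3 → R3) (u : ℝ → R3 → R3), 0 < T → MemLp u₀ 2 volume →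
    IsLerayHopfOn T 1 0 u₀ u → ¬ IsRegularOn T u →
      ∃ (t₁ T' : ℝ) (v : ℝ → R3 → R3) (q : ℝ → R3 → ℝ),
        0 ≤ t₁ ∧ t₁ + T' ≤ T ∧ IsBlowup T' (v 0) v q ∧ ∀ s ∈ Ico 0 T', v s =ᵐ[volume] u (t₁ + s)

/-- **Step 2** ((3.1) l.726–732 p.9; Motivation 1 l.361–367 p.3): «Let `φ ∈ C₀^∞(ℝ³,[0,1])` be a
radial symmetrical function satisfying (3.1)» — such a cut-off exists. [cite: Zhai2014, (3.1), p. 9] -/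
def Step_2 : Prop :=
  ∃ φ : R3 → ℝ, IsLPCutoff φ

/-- **Step 3 — the criterion** (Prop. 3.2 l.1035–1060 p.14: «There is `δ = δ(α) > 0` such that if
(3.11) (Assumption 1) [at `τ₀`] then for all `τ > τ₀` (3.12) … (3.13) (3.14)»; §4 Lemmas 4.1–4.3
l.1191–1436 pp.17–20 (regularity at `T` under Assumption 1); §6.5 l.2226–2231 p.35: «from Lemma
4.1–4.3 and Proposition 3.2, as well as former results on … the Serrin regularity condition of
Leray-Hopf solutions ([G][L][Se][Z]), we discover that `u` can be extended smoothly over `T`»), for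
`α ∈ (0, 1/8)` (l.368): if a Leray–Hopf solution, classical on `[0,T)`, satisfies Assumption 1 at
some `t ∈ (0,T)`, then it is regular on some `(0,T'')`, `T'' > T`. [cite: Zhai2014, Prop. 3.2, p. 14] -/
def Step_3 : Prop :=
  ∀ φ : R3 → ℝ, IsLPCutoff φ → ∀ α : ℝ, 0 < α → α < 1 / 8 →
    ∃ δ : ℝ, 0 < δ ∧
      ∀ (T t : ℝ) (u₀ : R3 → R3) (u : ℝ → R3 → R3) (p : ℝ → R3 → ℝ),
        0 < t → t < T → (∃ Tplus : ℝ, T < Tplus ∧ IsLerayHopfOn Tplus 1 0 u₀ u) →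
        IsClassicalNSSolutionOn (Ico 0 T) 1 0 u p → u 0 = u₀ →
        AssumptionOne φ α δ T t (u t) →
          ∃ T'' : ℝ, T < T'' ∧ IsRegularOn T'' u

/-- **Step 4 — reduction by scaling** (§6.1–§6.2 l.1635–1714 pp.23–25): for a threshold `δ`
(= `δ₀`, l.1635), if SOME blow-up element exists (the set `E` of l.1637–1640, or a datum outside `E`),
then — near-extremal datum `C_{3.11} ≤ T̃^{-1/4}‖ũ₀‖₂ ≤ 2C_{3.11}` (l.1641–1650), rescalings `λ_δ`
(l.1663–1669) and `λ_γ` (l.1687–1705), Lemma 2.1's dichotomy «in this case (3.11) is satisfied for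
`T̂ − t̂` small enough» (l.1673–1677), the re-basing «Simply we assume `h₀ = 0`» (l.1685) — for every
prescribed smallness of `γ₁` and of `‖u₀‖₂` («`→ 0` as `γ₁ → 0`», l.1693, l.1698) there is a blow-up
element which EITHER satisfies Assumption 1 at some time, OR satisfies (6.3) together with the data
conditions at the re-based time (`RebasedData`, unprinted, referee L0, made explicit here because
(6.8), Lemma 6.1 and (3.37) use them). The absolute constants `M₂`, `C₆₁` and the exponents `ε`,
`ε_b` ((3.35), chosen before `γ₁ → 0`) are inputs. [cite: Zhai2014, §6.2 (6.3), p. 25] -/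
def Step_4 : Prop :=
  ∀ (φ : R3 → ℝ) (α δ M₂ C₆₁ ε ε_b : ℝ), IsLPCutoff φ → 0 < α → α < 1 / 12 → 0 < δ →
    0 < M₂ → 0 < C₆₁ → 0 < ε → ε_b < 2 * ε → ε / (3 / 4 - α) < ε_b →
    (∃ (T : ℝ) (u₀ : R3 → R3) (u : ℝ → R3 → R3) (p : ℝ → R3 → ℝ), IsBlowup T u₀ u p) →
    ∀ γ κ : ℝ, 0 < γ → 0 < κ →
      ∃ (P : Params) (T : ℝ) (u₀ : R3 → R3) (u : ℝ → R3 → R3) (p : ℝ → R3 → ℝ),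
        P.α = α ∧ P.ε = ε ∧ P.ε_b = ε_b ∧ P.γ₁ < γ ∧ P.Printed δ ∧ IsBlowup T u₀ u p ∧
        l2 u₀ < κ ∧
        ((∃ t : ℝ, 0 < t ∧ t < T ∧ AssumptionOne φ α δ T t (u t)) ∨
          (Satisfies63 P.γ₁ P.δhat T u₀ u ∧ RebasedData M₂ C₆₁ P T u₀))

/-- **Step 5 — Lemma 6.1** (l.1742–1747, p.25): with `v(x,t) = u(x,t) − S(t)u₀`, `S(h) = exp{hΔ}`
the heat semigroup (l.1722–1726; tree `heatExtension u₀ h`), «For all `0 < h < T`,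
`‖∇ₓv(h)‖_{L¹(ℝ³)} ≤ C(‖u₀‖₂² + T‖u₀‖₂‖∇ₓ²u₀‖₂)`», for a smooth epoch (the `u` of §6.2; data
smooth with `∇²u₀ ∈ L²`; the printed proof l.1749–1817 uses only the equation (7.2*) and the energy
class). [cite: Zhai2014, Lemma 6.1, p. 25] -/
def Step_5 : Prop :=
  ∃ C : ℝ, 0 < C ∧
    ∀ (T : ℝ) (u₀ : R3 → R3) (u : ℝ → R3 → R3) (p : ℝ → R3 → ℝ),
      IsSmoothEpoch T u₀ u p → eHessL2 u₀ < ⊤ →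
      ∀ h : ℝ, 0 < h → h < T →
        eGradL1 (u h - heatExtension u₀ h) ≤
          ENNReal.ofReal (C * (l2 u₀ ^ 2 + T * l2 u₀ * (eHessL2 u₀).toReal))

/-- **Step 6 — the parameter choice is possible** (pure real arithmetic): (a) (3.35)/(6.8.0)
l.2059–2062, l.2119–2121: for `α ∈ (0, 1/12)` there are `ε > 0`, `ε_b` with `2ε > ε_b > ε/(¾ − α)`
(then `2(ε − 8γ₁) > ε_b` for all small `γ₁`); (b) (3.24) l.1827, (3.29) l.1831, (3.35) l.2059,
`b ∈ (½,1)` l.2053, `h₀ = T^{1+4γ₁} < t < T` (Lemma 6.2): for printed parameters, `T ∈ (0,1)` and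
`‖u₀‖₂ ∈ (0, ½)` with `‖u₀‖₂^{ε_b} < ½` (so that `b = 1 − ‖u₀‖₂^{ε_b} ∈ (½,1)`; `‖u₀‖₂ → 0`, l.1693)
there are `t, β₀, β₁, b` fitting all displayed relations («For example, (3.35)», l.2058).
[cite: Zhai2014, (3.24) (3.29) (3.35) (6.8.0), pp. 29–33] -/
def Step_6 : Prop :=
  (∀ α : ℝ, 0 < α → α < 1 / 12 →
      ∃ ε ε_b : ℝ, 0 < ε ∧ ε_b < 2 * ε ∧ ε / (3 / 4 - α) < ε_b) ∧
    ∀ (δ : ℝ) (P : Params) (T nrm : ℝ), P.Printed δ → 0 < T → T < 1 → 0 < nrm → nrm < 1 / 2 →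
      nrm ^ P.ε_b < 1 / 2 → ∃ S : Scales, S.Fit P T nrm

/-- **Step 7 — Lemma 6.2 as used** (statement l.2117–2127, p.33: «Take `h₀ = T^{1+4γ₁}`. Suppose
(3.24) (3.35), that is (6.8.0). Then `‖Δ̃ᵗ₋₁u(h)‖₂ + ‖√Δ₀ᵗu(h)‖₂ = o((T−t)^{¼+2αβ₁})` for `h > h₀`.
Particularly at `h = t` we have (3.11).»; the proof delivers, for `h ∈ (h₀, t]`, the inequality
(6.9.2) l.2160–2165 `≤ 2((1−b)^{ε_c}λ_tσ_Q)^{½+2α}‖u₀‖₂` (referee F3: the printed `o(·)` at the one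
fixed `t` is typed as this inequality), and §6.5 uses the conclusion «(3.11) at `t`»). Typed
CONCRETELY for a smooth epoch satisfying (6.3), the re-based data conditions and the fitted scales
(the printed proof uses (6.3), (6.8), Lemma 6.1 and the parameter web, never the blow-up at `T`);
the absolute constants `M₂` (Prop. 5.1), `C₆₁` (Lemma 6.1) are existentially quantified.
[cite: Zhai2014, Lemma 6.2, p. 33] -/
def Step_7 : Prop :=
  ∃ M₂ C₆₁ : ℝ, 0 < M₂ ∧ 0 < C₆₁ ∧
    ∀ (φ : R3 → ℝ) (δ : ℝ) (P : Params) (S : Scales) (T : ℝ) (u₀ : R3 → R3) (u : ℝ → R3 → R3)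
      (p : ℝ → R3 → ℝ),
      IsLPCutoff φ → 0 < δ → P.Printed δ → IsSmoothEpoch T u₀ u p → Satisfies63 P.γ₁ P.δhat T u₀ u →
      RebasedData M₂ C₆₁ P T u₀ → S.Fit P T (l2 u₀) →
        (∀ h ∈ Ioc (T ^ (1 + 4 * P.γ₁)) S.t,
            lowHighNorm φ P.α T S.t (u h) ≤ ENNReal.ofReal (bound692 P S T (l2 u₀))) ∧
          AssumptionOne φ P.α δ T S.t (u S.t)

/-- CHARITABLE variant of Step 7: the same with `Params.PrintedCharitable` (`1 < ε_c < 2`, l.1849)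
in place of `Params.Printed` (`ε_c = ½`). Not a printed Step. [cite: Zhai2014, Lemma 6.2 p. 33 with l.1849 p. 30] -/
def Step_7' : Prop :=
  ∃ M₂ C₆₁ : ℝ, 0 < M₂ ∧ 0 < C₆₁ ∧
    ∀ (φ : R3 → ℝ) (δ : ℝ) (P : Params) (S : Scales) (T : ℝ) (u₀ : R3 → R3) (u : ℝ → R3 → R3)
      (p : ℝ → R3 → ℝ),
      IsLPCutoff φ → 0 < δ → P.PrintedCharitable δ → IsSmoothEpoch T u₀ u p →
      Satisfies63 P.γ₁ P.δhat T u₀ u → RebasedData M₂ C₆₁ P T u₀ → S.Fit P T (l2 u₀) →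
        (∀ h ∈ Ioc (T ^ (1 + 4 * P.γ₁)) S.t,
            lowHighNorm φ P.α T S.t (u h) ≤ ENNReal.ofReal (bound692 P S T (l2 u₀))) ∧
          AssumptionOne φ P.α δ T S.t (u S.t)

/-! ### Inside the proof of Lemma 6.2 (l.2131–2223): displayed quantities and sub-steps -/

/-- The DISPLAYED time-functions of (3.38) l.2077–2082 (p.33) for the fixed `t` (abstract grain; the
multiplier pieces `Δ̂ᵗ₋₁` (3.30.1), `u^{Q+}` (3.29.1), `u^{1−μ_t^{β₁}}` are not typed concretely):
`E(h) = ‖Δ̂ᵗ₋₁u(h)‖₂² + ‖√Δ₀ᵗu(h)‖₂²`, its derivative `E'`, the dissipation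
`D(h) = ‖∇ₓΔ̂ᵗ₋₁u(h)‖₂² + ‖∇ₓ√Δ₀ᵗu(h)‖₂²`, `G₁(h) = ‖∇ₓu(h)‖_{L¹}`, `Qp(h) = ‖u^{Q+}(h)‖₂`,
`Hi(h) = (‖Δ̂ᵗ₋₁u^{1−μ_t^{β₁}}(h)‖₂² + ‖√Δ₀ᵗu(h)‖₂²)^{1/2}`. [cite: Zhai2014, (3.38), p. 33] -/
structure Displayed where
  /-- `E(h) = ‖Δ̂ᵗ₋₁u(h)‖₂² + ‖√Δ₀ᵗu(h)‖₂²`. -/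
  E : ℝ → ℝ
  /-- `dE/dh`. -/
  E' : ℝ → ℝ
  /-- `D(h) = ‖∇ₓΔ̂ᵗ₋₁u(h)‖₂² + ‖∇ₓ√Δ₀ᵗu(h)‖₂²`. -/
  D : ℝ → ℝ
  /-- `G₁(h) = ‖∇ₓu(h)‖_{L¹}`. -/
  G₁ : ℝ → ℝ
  /-- `Qp(h) = ‖u^{Q+}(h)‖_{L²}`. -/
  Qp : ℝ → ℝ
  /-- `Hi(h) = (‖Δ̂ᵗ₋₁u^{1−μ_t^{β₁}}(h)‖₂² + ‖√Δ₀ᵗu(h)‖₂²)^{1/2}`. -/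
  Hi : ℝ → ℝ

/-- The bracket of (3.38) l.2077–2082: `1 − (T−t)^{-1/4}E(h)^{1/2}
− 50((1−b)^{1−(1−ε_c)(½+2α)}σ_Q G₁(h) + (1−b)^{−(1+ε_c)(½+2α)}σ_Q^{1/2} Qp(h)) − C(α)(T−t)^{−(¼+2αβ₁)} Hi(h)`,
with `σ_Q = (T−t)^{β₁−½} = nrm^{−(2+ε)}` by (3.35). [cite: Zhai2014, (3.38), p. 33] -/
def Displayed.bracket338 (X : Displayed) (P : Params) (S : Scales) (T nrm Cα : ℝ) (h : ℝ) : ℝ :=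
  1 - (T - S.t) ^ (-(1 / 4 : ℝ)) * Real.sqrt (X.E h)
    - 50 * ((1 - S.b) ^ (1 - (1 - P.ε_c) * (1 / 2 + 2 * P.α)) * nrm ^ (-(2 + P.ε)) * X.G₁ h
        + (1 - S.b) ^ (-((1 + P.ε_c) * (1 / 2 + 2 * P.α))) * Real.sqrt (nrm ^ (-(2 + P.ε))) * X.Qp h)
    - Cα / (T - S.t) ^ (1 / 4 + 2 * P.α * S.β₁) * X.Hi h

/-- **(3.38)** l.2077–2082 (p.33) as a property of the displayed functions on `(0,T)`:
`dE/dh ≤ −D(h) · bracket338(h)`. [cite: Zhai2014, (3.38), p. 33] -/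
def Displayed.Ineq338 (X : Displayed) (P : Params) (S : Scales) (T nrm Cα : ℝ) : Prop :=
  ∀ h ∈ Ioo 0 T, HasDerivAt X.E (X.E' h) h ∧ X.E' h ≤ -(X.D h) * X.bracket338 P S T nrm Cα h

/-- **Step 7a — proof of Lemma 6.2, Step 1, AS PRINTED** (l.2131–2165, p.33–34): from (6.8)–(6.9),
(3.39) and (3.33) «we find that the right side of (3.38) at `h = h₀` is strictly negative and from
the continuity, for `h₀ < h < ∃h₁`» (6.9.1) `dE/dh < −D(h)` and (6.9.2) `E(h) ≤ E(h₀)`. Abstract grain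
over `Displayed`: (3.38), continuity of the bracket and of `D` at `h₀`, positivity of the bracket and
of `D` at `h₀` ⇒ the printed (6.9.1)–(6.9.2) on some `(h₀, h₁)`. (The printed `< −D` is recorded
as printed; see `Step_7a'` for the reading (6.9.2) uses.) [cite: Zhai2014, (6.9.1)–(6.9.2), p. 34] -/
def Step_7a : Prop :=
  ∀ (X : Displayed) (P : Params) (S : Scales) (T nrm Cα h₀ : ℝ),
    0 < h₀ → h₀ < S.t → S.t < T → X.Ineq338 P S T nrm Cα →
    ContinuousWithinAt (X.bracket338 P S T nrm Cα) (Ici h₀) h₀ →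
    ContinuousWithinAt X.D (Ici h₀) h₀ →
    0 < X.bracket338 P S T nrm Cα h₀ → 0 < X.D h₀ →
      ∃ h₁ : ℝ, h₀ < h₁ ∧ h₁ ≤ S.t ∧ ∀ h ∈ Ioo h₀ h₁, X.E' h < -(X.D h) ∧ X.E h ≤ X.E h₀

/-- **Step 7a′ — proof of Lemma 6.2, Step 1, CHARITABLE** (l.2131–2165): as `Step_7a` with the
conclusion `dE/dh < 0` (what (3.38) with a positive bracket gives and what (6.9.2) uses) in place of
the printed (6.9.1) `dE/dh < −D`. [cite: Zhai2014, (6.9.1)–(6.9.2), p. 34] -/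
def Step_7a' : Prop :=
  ∀ (X : Displayed) (P : Params) (S : Scales) (T nrm Cα h₀ : ℝ),
    0 < h₀ → h₀ < S.t → S.t < T → X.Ineq338 P S T nrm Cα →
    ContinuousWithinAt (X.bracket338 P S T nrm Cα) (Ici h₀) h₀ →
    ContinuousWithinAt X.D (Ici h₀) h₀ →
    0 < X.bracket338 P S T nrm Cα h₀ → 0 < X.D h₀ →
      ∃ h₁ : ℝ, h₀ < h₁ ∧ h₁ ≤ S.t ∧ ∀ h ∈ Ioo h₀ h₁, X.E' h < 0 ∧ X.E h ≤ X.E h₀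

/-- **Step 7b — proof of Lemma 6.2, Steps 2–3** (l.2168–2218, p.34–35), concrete in its conclusion:
at a time `h₁ ∈ (h₀, t)` up to which (6.9.2) holds, EITHER (3.40.1) holds and then (6.33)
`d/dh (‖Δ̃ᵗ₋₁u‖₂² + ‖√Δ₀ᵗu‖₂²)^{1/2} < 0` at `h₁`, OR (3.40.1) fails and then (6.34)–(6.37) give (6.36)
`‖∇ₓu(h₁)‖₂ ≤ ‖u₀‖₂^{-2}`, «provided that (6.38)» (first line of (6.38), l.2213, typed; its second,
asymptotic line in `λ_γλ_δ` is not). [cite: Zhai2014, (6.33) (6.36) (6.38), pp. 34–35] -/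
def Step_7b : Prop :=
  ∃ M₂ C₆₁ : ℝ, 0 < M₂ ∧ 0 < C₆₁ ∧
    ∀ (φ : R3 → ℝ) (δ : ℝ) (P : Params) (S : Scales) (T : ℝ) (u₀ : R3 → R3) (u : ℝ → R3 → R3)
      (p : ℝ → R3 → ℝ) (h₁ : ℝ),
      IsLPCutoff φ → 0 < δ → P.Printed δ → IsSmoothEpoch T u₀ u p → Satisfies63 P.γ₁ P.δhat T u₀ u →
      RebasedData M₂ C₆₁ P T u₀ → S.Fit P T (l2 u₀) →
      0 < 3 / 2 + 10 * P.α - 2 * P.ε * (1 - P.α) + 2 * P.ε_b * P.ε_c * (1 / 2 + 2 * P.α) →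
      T ^ (1 + 4 * P.γ₁) < h₁ → h₁ < S.t →
      (∀ h ∈ Ioc (T ^ (1 + 4 * P.γ₁)) h₁,
          lowHighNorm φ P.α T S.t (u h) ≤ ENNReal.ofReal (bound692 P S T (l2 u₀))) →
        deriv (fun h => Real.sqrt (lowHighEnergy φ P.α T S.t (u h)).toReal) h₁ < 0 ∨
          eGradL2 (u h₁) ≤ ENNReal.ofReal ((l2 u₀ ^ 2)⁻¹)

/-- **(6.8) at base time `h`** (l.2132–2136, p.33, with `h₀` replaced by a general `h` — the form the
closure «return to the Step 1 by replacing `h₀` by `h₁`» needs): the high-frequency vorticity bound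
drawn from Prop. 5.1, `‖𝓕[ω](h)‖_{L²(|ξ| ≥ (1−b)^{ε_c}/(T−t)^{½−β₁})} ≤ (2M₂h^{1/4})^{-1}
exp[−√h (1−b)^{ε_c}/(T−t)^{½−β₁}]`, `(T−t)^{½−β₁} = ‖u₀‖₂^{2+ε}` by (3.35); the binder `w` stands for the vorticity
slice, with the `L¹` guard making `fourierVec w` honest. [cite: Zhai2014, (6.8), p. 33] -/
def HighFreqVorticityDecay (M₂ : ℝ) (P : Params) (S : Scales) (nrm : ℝ) (w : R3 → R3) (h : ℝ) :
    Prop :=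
  Integrable w volume ∧
    (∫⁻ ξ in {ξ : R3 | (1 - S.b) ^ P.ε_c / nrm ^ (2 + P.ε) ≤ ‖ξ‖}, ‖fourierVec w ξ‖ₑ ^ 2) ^
        (1 / 2 : ℝ) ≤
      ENNReal.ofReal ((2 * M₂ * h ^ (1 / 4 : ℝ))⁻¹ *
        Real.exp (-(Real.sqrt h * (1 - S.b) ^ P.ε_c / nrm ^ (2 + P.ε))))

/-- **Step 7c — the CLOSURE of the proof of Lemma 6.2** (l.2219–2223, p.35): «Then we can return to
the Step 1 by replacing `h₀` by `h₁`. So (3.11) is satisfied for `u` at `t`.» — i.e. at a time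
`h₁ ∈ (h₀, t)` where Step 3 has produced (6.36) `‖∇ₓu(h₁)‖₂ ≤ ‖u₀‖₂^{-2}`, the input (6.8) of Step 1 is
available again WITH `h₀` REPLACED BY `h₁` (Prop. 5.1's exponential high-frequency vorticity decay
at base time `h₁`). Typed concretely for the `u` of (6.3); `M₂` as in `Step_7`. Its
real-number grain is `RestartWindow`. Typed over smooth epochs. [cite: Zhai2014, §6.4 l.2219–2223, p. 35] -/
def Step_7c : Prop :=
  ∃ M₂ C₆₁ : ℝ, 0 < M₂ ∧ 0 < C₆₁ ∧
    ∀ (δ : ℝ) (P : Params) (S : Scales) (T : ℝ) (u₀ : R3 → R3) (u : ℝ → R3 → R3)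
      (p : ℝ → R3 → ℝ) (h₁ : ℝ),
      0 < δ → P.Printed δ → IsSmoothEpoch T u₀ u p → Satisfies63 P.γ₁ P.δhat T u₀ u →
      RebasedData M₂ C₆₁ P T u₀ → S.Fit P T (l2 u₀) →
      T ^ (1 + 4 * P.γ₁) < h₁ → h₁ < S.t →
      eGradL2 (u h₁) ≤ ENNReal.ofReal ((l2 u₀ ^ 2)⁻¹) →
        HighFreqVorticityDecay M₂ P S (l2 u₀) (curl (u h₁)) h₁

/-! ### F15 companions (abstract grain; NOT steps of the printed proof) -/

/-- **RestartWindow** (F15 companion of `Step_7c`, referee R1; NOT printed): restarting Prop. 5.1 at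
`t₀ = h₁` with `K₀ = ‖ω(h₁)‖₂` of size `‖u₀‖₂^{-2}` ((6.36)) requires by (5.5) l.1580 a window
`T* − h₁ ≤ (7‖u₀‖₂²/(64M₂))⁴`; for the closure to advance in steps comparable to `h₀ = T^{1+4γ₁}`
one needs `T^{1+4γ₁} ≤ (7‖u₀‖₂²/(64M₂))⁴` with `‖u₀‖₂ = T^{¼−γ₁}δ̂^{1/2}/2` from (6.3). Stated over
the printed parameter ranges as a real-number inequality. [cite: Zhai2014, (5.5) p. 22 with (6.3) p. 25 and (6.36) p. 35] -/
def RestartWindow : Prop :=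
  ∀ (M₂ γ₁ T δhat : ℝ), 0 < M₂ → 0 < γ₁ → γ₁ < 1 / 100 → 0 < T → T < (1 / 2 : ℝ) ^ (1 / γ₁) →
    0 < δhat → δhat < 1 →
      T ^ (1 + 4 * γ₁) ≤ (7 * (T ^ (1 / 4 - γ₁) * (Real.sqrt δhat / 2)) ^ 2 / (64 * M₂)) ^ (4 : ℕ)

/-- **QPlusPropagation** (F15 companion, referee R2; NOT printed): propagating the `u^{Q+}`-smallness
(c) of (3.38) from `h₀` to later `h` by the monotonicity (6.9.2) of `E` alone requires, after (3.35),
`200‖u₀‖₂^{−ε/2} ≤ ‖u₀‖₂^{ε_b(1+4α)}` for the (small) norm `‖u₀‖₂ ∈ (0,1)`. [cite: Zhai2014, (3.38) p. 33 with (3.35) p. 32] -/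
def QPlusPropagation : Prop :=
  ∀ (α ε ε_b nrm : ℝ), 0 < α → α < 1 / 12 → 0 < ε → ε_b < 2 * ε → ε / (3 / 4 - α) < ε_b →
    0 < nrm → nrm < 1 → 200 * nrm ^ (-(ε / 2)) ≤ nrm ^ (ε_b * (1 + 4 * α))

/-- **ShellOrdering** (l.1846–1849, p.30, F-level companion; NOT a Step): the printed ordering of the
shells (3.29.1) `σ_Q > (1−b)σ_Q > (1−b)^{ε_c}σ_Q > (1−b)²σ_Q ≥ σ₀` «and `0 < 1−b < 1` as well as
`1 < ε_c < 2` will be determined later», with `σ₀ = 4` (3.24) and `σ_Q = ‖u₀‖₂^{−(2+ε)}` (3.35); to be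
read against `Params.Printed.ε_c_eq` (`ε_c = ½`). [cite: Zhai2014, §6.4 l.1846–1849, p. 30] -/
def ShellOrdering (P : Params) (S : Scales) (nrm : ℝ) : Prop :=
  0 < 1 - S.b ∧ 1 - S.b < 1 ∧ 1 < P.ε_c ∧ P.ε_c < 2 ∧
    (1 - S.b) * nrm ^ (-(2 + P.ε)) < nrm ^ (-(2 + P.ε)) ∧
    (1 - S.b) ^ P.ε_c * nrm ^ (-(2 + P.ε)) < (1 - S.b) * nrm ^ (-(2 + P.ε)) ∧
    (1 - S.b) ^ (2 : ℕ) * nrm ^ (-(2 + P.ε)) < (1 - S.b) ^ P.ε_c * nrm ^ (-(2 + P.ε)) ∧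
    4 ≤ (1 - S.b) ^ (2 : ℕ) * nrm ^ (-(2 + P.ε))

/-! ## Composition -/

/-- **COMPOSITION** (§6.5 l.2226–2231, p.35: «Since every initial data in the set `E` can satisfy the
assumption 1 in Proposition 3.2 by scaling, from Lemma 4.1–4.3 and Proposition 3.2 … we discover
that `u` can be extended smoothly over `T`. Finally we proved Theorem 1.1.»): the typed Steps imply
the claimed theorem. PROVED; no Step is asserted. [cite: Zhai2014, §6.5, p. 35] -/
theorem claim_of_steps (h1 : Step_1) (h2 : Step_2) (h3 : Step_3) (h4 : Step_4) (h6 : Step_6)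
    (h7 : Step_7) : ClaimedTheorem := by
  intro T u₀ u hT hu₀ hLH
  by_contra hreg
  -- Step 1: a blow-up element exists.
  obtain ⟨t₁, T', v, q, -, -, hB, -⟩ := h1 T u₀ u hT hu₀ hLH hreg
  -- Step 2: fix a cut-off; fix `α = 1/24`.
  obtain ⟨φ, hφ⟩ := h2
  have hα : (0 : ℝ) < 1 / 24 := by norm_num
  have hα8 : (1 / 24 : ℝ) < 1 / 8 := by norm_num
  have hα12 : (1 / 24 : ℝ) < 1 / 12 := by norm_num
  -- Step 3: the threshold `δ = δ(α)`.
  obtain ⟨δ, hδ, hcrit⟩ := h3 φ hφ (1 / 24) hα hα8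
  -- Step 7's absolute constants and Step 6(a)'s exponents.
  obtain ⟨M₂, C₆₁, hM₂, hC, hL62⟩ := h7
  obtain ⟨h6a, h6b⟩ := h6
  obtain ⟨ε, ε_b, hε, hεb, hεb'⟩ := h6a (1 / 24) hα hα12
  -- Step 4: a blow-up element satisfying Assumption 1 or (6.3) + re-based data conditions.
  -- the prescribed smallness of `‖u₀‖₂`: below `1/2` and below `(1/2)^{1/ε_b}`.
  have hεb0 : 0 < ε_b := lt_trans (div_pos hε (by norm_num)) hεb'
  have hκ0 : (0 : ℝ) < min (1 / 2) ((1 / 2 : ℝ) ^ (1 / ε_b)) :=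
    lt_min (by norm_num) (Real.rpow_pos_of_pos (by norm_num) _)
  obtain ⟨P, T₁, w₀, w, r, hPα, -, hPεb, -, hPr, hBw, hκ, hcase⟩ :=
    h4 φ (1 / 24) δ M₂ C₆₁ ε ε_b hφ hα hα12 hδ hM₂ hC hε hεb hεb' ⟨T', v 0, v, q, hB⟩ 1
      (min (1 / 2) ((1 / 2 : ℝ) ^ (1 / ε_b))) one_pos hκ0
  obtain ⟨hκ1, hκ2⟩ := lt_min_iff.mp hκ
  -- In either case Assumption 1 holds at some time `t ∈ (0, T₁)`.
  have hA1 : ∃ t : ℝ, 0 < t ∧ t < T₁ ∧ AssumptionOne φ (1 / 24) δ T₁ t (w t) := by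
    rcases hcase with hdirect | ⟨h63, hdata⟩
    · exact hdirect
    · have hT₁ : 0 < T₁ := hBw.pos
      have hT₁' : T₁ < 1 := by
        refine lt_of_lt_of_le h63.T_lt ?_
        exact Real.rpow_le_one (by norm_num) (by norm_num)
          (le_of_lt (div_pos one_pos hPr.γ₁_pos))
      have hnrm : 0 < l2 w₀ := by
        rw [h63.norm_eq]
        exact mul_pos (Real.rpow_pos_of_pos hT₁ _)
          (div_pos (Real.sqrt_pos.mpr hPr.δhat_pos) two_pos)
      have hnrmb : l2 w₀ ^ P.ε_b < 1 / 2 := by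
        rw [hPεb]
        calc l2 w₀ ^ ε_b < ((1 / 2 : ℝ) ^ (1 / ε_b)) ^ ε_b :=
              Real.rpow_lt_rpow hnrm.le hκ2 hεb0
          _ = 1 / 2 := by
              rw [← Real.rpow_mul (by norm_num : (0 : ℝ) ≤ 1 / 2), one_div_mul_cancel hεb0.ne',
                Real.rpow_one]
      obtain ⟨S, hS⟩ := h6b δ P T₁ (l2 w₀) hPr hT₁ hT₁' hnrm hκ1 hnrmb
      obtain ⟨-, hA⟩ := hL62 φ δ P S T₁ w₀ w r hφ hδ hPr hBw.isSmoothEpoch h63 hdata hS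
      refine ⟨S.t, ?_, hS.t_lt, ?_⟩
      · exact lt_trans (Real.rpow_pos_of_pos hT₁ _) hS.h₀_lt
      · simpa [hPα] using hA
  obtain ⟨t, ht, htT, hA⟩ := hA1
  -- Step 3: the solution extends smoothly over its first singular time — contradiction.
  obtain ⟨T'', hT'', hreg''⟩ := hcrit T₁ t w₀ w r ht htT hBw.horizon hBw.classical hBw.initial hA
  exact hBw.first_blowup T'' hT'' hreg''

/-! ## Clay link -/

/-- **LHBridge** (named delta, classical bookkeeping, NOT from the paper): for a Clay datum `u₀`
(smooth, divergence-free, rapidly decaying — Fefferman (4)), `u₀ ∈ L²` and is weakly divergence-free,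
and a GLOBAL Leray–Hopf solution from `u₀` (`ν = 1`, `f ≡ 0`) that is regular on every
`ℝ³ × (0,T)` is (after modification on null sets, with its pressure, smooth up to `t = 0`, of
bounded energy) a solution in the sense of Fefferman's (A) — Leray's comparison of a «solution
turbulente» with the «solution régulière» from the same (regular) datum while the latter exists,
his local regular solution for regular data, and the energy inequality.
[cite: Leray1934, §33 (comparaison des solutions turbulentes et régulières) with §§19–22]
[cite: FeffermanClay2006, (A) with (1)–(4), (6), (7), p. 1–2] -/
def LHBridge : Prop :=
  ∀ u₀ : R3 → R3, ContDiff ℝ ∞ u₀ → NSWave0.IsDivFree u₀ → HasRapidSpatialDecay u₀ →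
    MemLp u₀ 2 volume ∧ IsWeaklyDivFree u₀ ∧
      ∀ u : ℝ → R3 → R3, IsGlobalLerayHopf 1 0 u₀ u → (∀ T : ℝ, 0 < T → IsRegularOn T u) →
        ClayVariants.clayR3.Solvable 1 0 u₀

/-- **Clay link** (PROVED): Leray's existence theorem (tree fact `leray_existence_R3`, a THEOREM of
the tree: `leray_existence_R3_holds`), the bookkeeping bridge `LHBridge` and the claimed Thm. 1.1
give Fefferman's (A) — at `ν = 1` first, then at every `ν` by `ClayVariants.clayR3_regularityAt_iff`
(«(A) at one viscosity is (A)»). The claim is STRONGER than (A); no wrong-problem axis.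
[cite: FeffermanClay2006, (A) p. 2] -/
theorem clay_of_claimed (hE : leray_existence_R3) (hB : LHBridge) (h : ClaimedTheorem) :
    ClayVariants.clayR3.Regularity := by
  rw [← ClayVariants.clayR3_regularityAt_iff one_pos]
  intro u₀ hs hdiv hdata
  obtain ⟨hL2, hwdiv, hsolv⟩ := hB u₀ hs hdiv hdata
  obtain ⟨u, hu⟩ := hE 1 one_pos u₀ hL2 hwdiv
  exact hsolv u hu fun T hT => h T u₀ u hT hL2 (hu T hT)


/-! ## Kernel record (APPEND-ONLY, 2026-08-27, ns-claims typist-8 g5; D-0026 debt pass): `Step_6` is TRUE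

Nothing above is edited. The parameter web of §6.2/§6.4 — (3.24), (3.29), (3.35), (6.8.0) — is
feasible by real arithmetic, so the on-path input `h6` of `claim_of_steps` is discharged in the kernel
and the composition's live inputs are Steps 1, 3, 4, 7 (locator of record: `Step_7` / `Step_7c`,
ADJUDICATED #63, untouched). Proof = the salvage aid of ns-claims-refuter-5 g0
(`claims/Zhai2014/SalvageAidZhai2014Step6.lean`, sha16 bf264b10ec42c5db, 2026-08-27T00:53Z), ported
verbatim into this namespace: (a) `ε = 1`, `ε_b = 3/2`; (b) `t = T − τ` with
`τ = ½·min(‖u₀‖₂^{2(2+ε)}, T − T^{1+4γ₁})`, `β₀ = ½ + ln 4/ln τ`, `β₁ = ½ − (2+ε)ln‖u₀‖₂/ln τ`,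
`b = 1 − ‖u₀‖₂^{ε_b}`.

WHAT THIS IS NOT: not a claim about NS regularity or blow-up; not a claim about any author beyond the
typed locator. -/

/-- **`Step_6` holds**: the parameter web (6.8.0) is nonempty for every `α ∈ (0, 1/12)` and, for
printed parameters, `T ∈ (0,1)`, `‖u₀‖₂ ∈ (0,½)` with `‖u₀‖₂^{ε_b} < ½`, the scales `t, β₀, β₁, b` of
(3.24)/(3.29)/(3.35) exist (explicit logarithmic choice, see the section docstring; proof by
ns-claims-refuter-5 g0). [cite: Zhai2014, (3.24) (3.29) (3.35) (6.8.0), pp. 29–33] -/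
theorem step6_holds : Step_6 := by
  refine ⟨?_, ?_⟩
  · intro α hα hα'
    refine ⟨1, 3 / 2, one_pos, by norm_num, ?_⟩
    rw [div_lt_iff₀ (by linarith)]
    linarith
  · intro δ P T nrm hP hT hT1 hn hn2 hnb
    -- the gap `τ = T − t`
    have hγ : 0 < P.γ₁ := hP.γ₁_pos
    have hε : 0 < P.ε := hP.ε_pos
    have hh₀ : T ^ (1 + 4 * P.γ₁) < T := by
      have := Real.rpow_lt_rpow_of_exponent_gt hT hT1 (show (1 : ℝ) < 1 + 4 * P.γ₁ by linarith)
      rwa [Real.rpow_one] at this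
    have hA : 0 < nrm ^ (2 * (2 + P.ε)) := Real.rpow_pos_of_pos hn _
    set τ : ℝ := min (nrm ^ (2 * (2 + P.ε))) (T - T ^ (1 + 4 * P.γ₁)) / 2 with hτ
    have hm : 0 < min (nrm ^ (2 * (2 + P.ε))) (T - T ^ (1 + 4 * P.γ₁)) :=
      lt_min hA (by linarith)
    have hτ0 : 0 < τ := by positivity
    have hτA : τ < nrm ^ (2 * (2 + P.ε)) := by
      have := min_le_left (nrm ^ (2 * (2 + P.ε))) (T - T ^ (1 + 4 * P.γ₁))
      rw [hτ]; linarith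
    have hτB : τ < T - T ^ (1 + 4 * P.γ₁) := by
      have := min_le_right (nrm ^ (2 * (2 + P.ε))) (T - T ^ (1 + 4 * P.γ₁))
      rw [hτ]; linarith
    have hn1 : nrm < 1 := by linarith
    have hA1 : nrm ^ (2 * (2 + P.ε)) < 1 := Real.rpow_lt_one hn.le hn1 (by positivity)
    have hτ1 : τ < 1 := lt_trans hτA hA1
    -- logarithms
    have hL : Real.log τ < 0 := Real.log_neg hτ0 hτ1
    have hLn : Real.log nrm < 0 := Real.log_neg hn hn1
    have hL0 : Real.log τ ≠ 0 := hL.ne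
    refine ⟨⟨T - τ, 1 / 2 + Real.log 4 / Real.log τ,
      1 / 2 - (2 + P.ε) * Real.log nrm / Real.log τ, 1 - nrm ^ P.ε_b⟩,
      ?_, ?_, ?_, ?_, ?_, ?_, ?_, ?_, ?_⟩
    · -- h₀_lt : T ^ (1 + 4γ₁) < T − τ
      show T ^ (1 + 4 * P.γ₁) < T - τ
      linarith
    · show T - τ < T
      linarith
    · -- β₁_pos
      show 0 < 1 / 2 - (2 + P.ε) * Real.log nrm / Real.log τ
      have h1 : Real.log τ < 2 * (2 + P.ε) * Real.log nrm := by
        have := Real.log_lt_log hτ0 hτA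
        rwa [Real.log_rpow hn] at this
      have h2 : (2 + P.ε) * Real.log nrm / Real.log τ < 1 / 2 := by
        rw [div_lt_iff_of_neg hL]
        linarith
      linarith
    · -- β₁_lt : β₁ < β₀
      show 1 / 2 - (2 + P.ε) * Real.log nrm / Real.log τ < 1 / 2 + Real.log 4 / Real.log τ
      have h1 : (2 + P.ε) * Real.log nrm < 2 * Real.log nrm := by nlinarith
      have h2 : 2 * Real.log nrm < -Real.log 4 := by
        have h3 : Real.log (nrm ^ 2) < Real.log (1 / 4) := by
          apply Real.log_lt_log (by positivity)
          nlinarith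
        rw [Real.log_pow, Real.log_div one_ne_zero four_ne_zero, Real.log_one] at h3
        push_cast at h3
        linarith
      have h4 : -((2 + P.ε) * Real.log nrm / Real.log τ) < Real.log 4 / Real.log τ := by
        rw [← neg_div, div_lt_div_right_of_neg hL]
        linarith
      linarith
    · -- σ₀_eq : (T − (T − τ)) ^ (β₀ − 1/2) = 4
      show (T - (T - τ)) ^ (1 / 2 + Real.log 4 / Real.log τ - 1 / 2) = 4
      rw [show T - (T - τ) = τ by ring, show 1 / 2 + Real.log 4 / Real.log τ - 1 / 2
        = Real.log 4 / Real.log τ by ring, Real.rpow_def_of_pos hτ0, mul_div_cancel₀ _ hL0,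
        Real.exp_log (by norm_num)]
    · -- σQ_eq : (T − (T − τ)) ^ (1/2 − β₁) = nrm ^ (2 + ε)
      show (T - (T - τ)) ^ (1 / 2 - (1 / 2 - (2 + P.ε) * Real.log nrm / Real.log τ))
        = nrm ^ (2 + P.ε)
      rw [show T - (T - τ) = τ by ring, show 1 / 2 - (1 / 2 - (2 + P.ε) * Real.log nrm / Real.log τ)
        = (2 + P.ε) * Real.log nrm / Real.log τ by ring, Real.rpow_def_of_pos hτ0,
        mul_div_cancel₀ _ hL0, Real.rpow_def_of_pos hn, mul_comm]
    · -- b_eq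
      show 1 - (1 - nrm ^ P.ε_b) = nrm ^ P.ε_b
      ring
    · -- b_gt
      show 1 / 2 < 1 - nrm ^ P.ε_b
      linarith
    · -- b_lt
      show 1 - nrm ^ P.ε_b < 1
      have := Real.rpow_pos_of_pos hn P.ε_b
      linarith

end

end Literature.Claims.NS.Zhai2014
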